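import Literature.MathematicalPhysics.QuantumLattice.MPSNestedMarginals
import HarnessLib

/-!
# Real moments of the coarse-grained chain

The certificates of the MPS relaxation are issued over REAL symmetric variables (Kull–Schuch–Dive–Navascués §3.3; sr-mbsolver
`FORMAT-ltisdp.md` §2 (a): "has real moments in the product basis"). At the true marginals this is inherited: for a REAL tensor
`A` (entrywise `conj A^s_{ab} = A^s_{ab}`) the words, the coarse-graining map `W_k` and hence `C_k(ρ)` of an entrywise real
window variable `ρ` are entrywise real; and the head marginals of an entrywise real window variable are entrywise real.
No `sorry`, no new axiom, no named fact. [cite: KullEtAl2024, §2.5, §3.3]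
-/

noncomputable section

namespace Literature.MathematicalPhysics.QuantumLattice

open Matrix Finset
open scoped ComplexOrder BigOperators Kronecker

namespace MPSCoarseGraining

section RealWords

variable {σ β : Type*} [Fintype β] [DecidableEq β]

/-- **Words of a real tensor are real.** [cite: KullEtAl2024, §2.5] -/
theorem star_word_apply {A : σ → Matrix β β ℂ} (hA : ∀ s a b, star (A s a b) = A s a b) :
    ∀ {k : ℕ} (t : Fin k → σ) (a b : β), star (word A t a b) = word A t a b := by
  intro k
  induction k with
  | zero =>
    intro t a b
    rw [word_zero, Matrix.one_apply]
    split_ifs <;> simp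
  | succ k ih =>
    intro t a b
    rw [word_succ, Matrix.mul_apply, star_sum]
    refine Finset.sum_congr rfl fun c _ => ?_
    rw [star_mul', hA, ih]

/-- **`W_k` of a real tensor is real.** [cite: KullEtAl2024, §2.5] -/
theorem star_cgMap_apply {A : σ → Matrix β β ℂ} (hA : ∀ s a b, star (A s a b) = A s a b) {k : ℕ} (ab : β × β)
    (t : Fin k → σ) : star (cgMap A k ab t) = cgMap A k ab t := by
  rw [cgMap_apply, star_word_apply hA]

end RealWords

section RealStates

variable {β : Type*} [Fintype β] [DecidableEq β] {q : ℕ}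

/-- The entries of `𝟙 ⊗ W_k ⊗ 𝟙` are real for a real tensor. [cite: KullEtAl2024, §2.5] -/
theorem star_one_kronecker_cgMap_kronecker_one_apply {A : Fin q → Matrix β β ℂ} (hA : ∀ s a b, star (A s a b) = A s a b)
    (k : ℕ) (i : Fin q × ((β × β) × Fin q)) (x : Fin q × ((Fin k → Fin q) × Fin q)) :
    star (((1 : Matrix (Fin q) (Fin q) ℂ) ⊗ₖ (cgMap A k ⊗ₖ (1 : Matrix (Fin q) (Fin q) ℂ))) i x) =
      ((1 : Matrix (Fin q) (Fin q) ℂ) ⊗ₖ (cgMap A k ⊗ₖ (1 : Matrix (Fin q) (Fin q) ℂ))) i x := by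
  obtain ⟨sL, ab, sR⟩ := i
  obtain ⟨u, t, w⟩ := x
  rw [Matrix.kroneckerMap_apply, Matrix.kroneckerMap_apply, star_mul', star_mul', star_cgMap_apply hA, Matrix.one_apply,
    Matrix.one_apply]
  congr 1
  · split_ifs <;> simp
  · congr 1
    split_ifs <;> simp

/-- **`C_k(ρ)` is entrywise real for a real tensor and an entrywise real window variable** (the `(Re)` rows of the relaxation
at the true marginals). [cite: KullEtAl2024, §2.5, §3.3] -/
theorem star_cgState_apply {A : Fin q → Matrix β β ℂ} (hA : ∀ s a b, star (A s a b) = A s a b) (k : ℕ) {ρ : Op (Fin (k + 2)) q}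
    (hρ : ∀ u v, star (ρ u v) = ρ u v) (i j : Fin q × ((β × β) × Fin q)) :
    star (cgState A k ρ i j) = cgState A k ρ i j := by
  rw [cgState, Matrix.mul_apply, star_sum]
  refine Finset.sum_congr rfl fun y _ => ?_
  rw [Matrix.mul_apply, star_mul', star_sum, Matrix.conjTranspose_apply, star_star,
    star_one_kronecker_cgMap_kronecker_one_apply hA]
  congr 1
  refine Finset.sum_congr rfl fun x _ => ?_
  rw [star_mul', star_one_kronecker_cgMap_kronecker_one_apply hA, Matrix.submatrix_apply, hρ]

/-- In `starRingEnd` form. [cite: KullEtAl2024, §3.3] -/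
theorem conj_cgState_apply {A : Fin q → Matrix β β ℂ} (hA : ∀ s a b, star (A s a b) = A s a b) (k : ℕ) {ρ : Op (Fin (k + 2)) q}
    (hρ : ∀ u v, starRingEnd ℂ (ρ u v) = ρ u v) (i j : Fin q × ((β × β) × Fin q)) :
    starRingEnd ℂ (cgState A k ρ i j) = cgState A k ρ i j :=
  star_cgState_apply hA k hρ i j

/-- `tr_R` of an entrywise real window variable is entrywise real. [cite: KullEtAl2024, §2.1] -/
theorem star_spinPartialTrace_castSuccEmb_apply {m : ℕ} {ρ : Op (Fin (m + 1)) q} (hρ : ∀ u v, star (ρ u v) = ρ u v)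
    (t s : TensorIndex (Fin m) q) : star (spinPartialTrace Fin.castSuccEmb ρ t s) = spinPartialTrace Fin.castSuccEmb ρ t s := by
  rw [spinPartialTrace_castSuccEmb_apply, star_sum]
  exact Finset.sum_congr rfl fun a _ => hρ _ _

/-- `tr_L` of an entrywise real window variable is entrywise real. [cite: KullEtAl2024, §2.1] -/
theorem star_spinPartialTrace_succEmb_apply {m : ℕ} {ρ : Op (Fin (m + 1)) q} (hρ : ∀ u v, star (ρ u v) = ρ u v)
    (t s : TensorIndex (Fin m) q) : star (spinPartialTrace (Fin.succEmb m) ρ t s) = spinPartialTrace (Fin.succEmb m) ρ t s := by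
  rw [spinPartialTrace_succEmb_apply, star_sum]
  exact Finset.sum_congr rfl fun a _ => hρ _ _

/-- **Head marginals of an entrywise real window variable are entrywise real.** [cite: KullEtAl2024, §2.1] -/
theorem star_headMarginal_apply {N : ℕ} {ρ : Op (Fin N) q} (hρ : ∀ u v, star (ρ u v) = ρ u v) :
    ∀ {m : ℕ} (h : m ≤ N) (t s : TensorIndex (Fin m) q), star (headMarginal h ρ t s) = headMarginal h ρ t s := by
  -- descend from `N` one site at a time
  suffices H : ∀ j m (h : m ≤ N), N = m + j → ∀ t s, star (headMarginal h ρ t s) = headMarginal h ρ t s from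
    fun {m} h t s => H (N - m) m h (by omega) t s
  intro j
  induction j with
  | zero =>
    intro m h hm t s
    subst hm
    rw [headMarginal_self]
    exact hρ t s
  | succ j ih =>
    intro m h hm t s
    have h' : m + 1 ≤ N := by omega
    rw [← spinPartialTrace_castSuccEmb_headMarginal h', star_spinPartialTrace_castSuccEmb_apply (ih (m + 1) h' (by omega))]

end RealStates

end MPSCoarseGraining

end Literature.MathematicalPhysics.QuantumLattice
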